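import Literature.NumberTheory.Transcendental.LinearSubgroupGaGmAuxiliary
import Literature.NumberTheory.Transcendental.LinearSubgroupGaGmSmallness
import Literature.NumberTheory.Transcendental.LinearSubgroupGaGmArithmetic
import Literature.NumberTheory.Transcendental.LinearSubgroupGaGmEndgame
import Literature.NumberTheory.Transcendental.LinearSubgroupGaGmParams
import Mathlib.NumberTheory.NumberField.House
import Mathlib.Analysis.Normed.Module.FiniteDimension
import HarnessLib

/-!
# The linear subgroup theorem on `𝔾ₐ × 𝔾ₘ^N` (Waldschmidt 1988, Thm 4.1), V: the construction

Topic `Literature/NumberTheory/Transcendental`; fifth file of the direct proof of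
[Waldschmidt1988, Thm 4.1] for `G = 𝔾ₐ × 𝔾ₘ^N` (plan in `LinearSubgroupGaGmAuxiliary.lean`).
Here parts I–III are assembled into the hypothesis of part IV (`linearSubgroup_of_vanishing`): in
the ARITHMETIC situation — generators `y_k = (σ(a_k), (z_{hk})_h)` with `e^{z_{hk}} = σ(θ_{kh})`,
letters `e_l = σ(ε_l)` spanning `W`, all data in a number field `K` embedded by `σ` — for every
large `S` there is a non-zero `P` with `deg_X P ≤ S^N L`, `deg_{Y_j} P ≤ S^{N-1} L⁴`
(`L = log₂ S + 1`) vanishing to order `≥ (N+1) S^N L² + 1` along `exp_G(W)` at the points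
`σ(μ)`, `0 ≤ μ_k ≤ (N+1)S` (`exists_auxiliaryPolynomial`), whence THEOREM 4.1 for `𝔾ₐ × 𝔾ₘ^N`
(`linearSubgroup_GaGm`). The parameters are those of [Waldschmidt1988, Prop. 6.1] with
`(a, b) = (2, 1)` up to the normalisation of the logarithms.

Everything here is PROVED; no definitions, no named facts.

## References

* [Waldschmidt1988] M. Waldschmidt, *On the transcendence methods of Gel'fond and Schneider in
  several variables*, New Advances in Transcendence Theory (A. Baker ed.), CUP 1988, 375–398, §4
  Thm 4.1, §6 Prop. 6.1, §7.
-/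

noncomputable section

open Finset Module Filter MvPolynomial Complex

namespace Literature.NumberTheory.Transcendental.LinearSubgroupGaGm

open GaGm DiazZL

variable {N : ℕ}

/-! ### Words are multilinear in their letters -/

/-- **Expansion of a word whose letters are linear combinations of an alphabet**:
`D_{u₀} ⋯ D_{u_{k-1}} P = ∑_w (∏ᵢ c_{i,w(i)}) · D_{e_{w(0)}} ⋯ D_{e_{w(k-1)}} P` for
`uᵢ = ∑_l c_{i,l} e_l`. [folklore] -/
theorem wordDeriv_linearCombination {t : ℕ} (e : Fin t → ℂ × (Fin N → ℂ)) :
    ∀ {k : ℕ} (c : Fin k → Fin t → ℂ) (P : MvPolynomial (Fin (N + 1)) ℂ),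
      wordDeriv (fun i => ∑ l, c i l • e l) P =
        ∑ w : Fin k → Fin t, (∏ i, c i (w i)) • wordDeriv (fun i => e (w i)) P := by
  intro k
  induction k with
  | zero =>
    intro c P
    rw [wordDeriv_zero, Fintype.sum_unique]
    simp
  | succ k ih =>
    intro c P
    have hcons : (fun i : Fin (k + 1) => ∑ l, c i l • e l) =
        Fin.cons (∑ l, c 0 l • e l) (fun i : Fin k => ∑ l, c i.succ l • e l) := by
      funext i; refine Fin.cases ?_ (fun i' => ?_) i <;> simp
    rw [hcons, wordDeriv_cons, ih (fun i => c i.succ) P, map_sum]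
    -- `D_{∑ c₀ₗ eₗ} = ∑ c₀ₗ D_{eₗ}`
    have hD : invDeriv (∑ l, c 0 l • e l) = ∑ l, c 0 l • invDeriv (e l) := by
      induction (Finset.univ : Finset (Fin t)) using Finset.induction_on with
      | empty => simp [invDeriv]
      | insert a s ha ih' => rw [Finset.sum_insert ha, Finset.sum_insert ha, invDeriv_add, invDeriv_smul, ih']
    rw [← (Fin.consEquiv fun _ : Fin (k + 1) => Fin t).sum_comp, Fintype.sum_prod_type]
    simp only [Fin.consEquiv_apply, Fin.prod_univ_succ, Fin.cons_zero, Fin.cons_succ]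
    rw [Finset.sum_comm]
    refine Finset.sum_congr rfl fun w _ => ?_
    rw [Derivation.map_smul, hD, sum_derivation_apply, Finset.smul_sum]
    refine Finset.sum_congr rfl fun l _ => ?_
    rw [Derivation.smul_apply, smul_smul, mul_comm (c 0 l),
      ← wordDeriv_cons (e l) (fun i => e (w i)) P]
    congr 1
    have : (fun i : Fin (k + 1) => e ((Fin.cons l w : Fin (k + 1) → Fin t) i)) =
        (Fin.cons (e l) fun i => e (w i) : Fin (k + 1) → _) := by
      funext i
      refine Fin.cases ?_ (fun i' => ?_) i <;> simp
    rw [this]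

/-- **Vanishing along `W` from the vanishing of the words in an alphabet spanning `W`.**
[folklore] -/
theorem vanishesToOrder_of_alphabet {t : ℕ} (e : Fin t → ℂ × (Fin N → ℂ))
    (P : MvPolynomial (Fin (N + 1)) ℂ) (g : GaGm N) (T : ℕ)
    (h : ∀ k < T, ∀ w : Fin k → Fin t, evalAt (wordDeriv (fun i => e (w i)) P) g = 0) :
    VanishesToOrder P (Submodule.span ℂ (Set.range e)) g T := by
  rw [vanishesToOrder_iff_wordDeriv]
  intro k hk u hu
  have hu' : ∀ i, ∃ c : Fin t → ℂ, u i = ∑ l, c l • e l := fun i =>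
    (Submodule.mem_span_range_iff_exists_fun ℂ).mp (hu i) |> fun ⟨c, hc⟩ => ⟨c, hc.symm⟩
  choose c hc using hu'
  have hu'' : u = fun i => ∑ l, c i l • e l := funext hc
  rw [hu'', wordDeriv_linearCombination, evalAt, map_sum]
  refine Finset.sum_eq_zero fun w _ => ?_
  rw [MvPolynomial.smul_eval, ← evalAt, h k hk w, mul_zero]

/-! ### The points `σ(μ)` are the points of part III -/

/-- The points `σ(μ) = exp_G(∑ μ_k y_k)`, `y_k = (ψ(a_k), (z_{hk})_h)`, `e^{z_{hk}} = ψ(θ_{kh})`, are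
the points `(ψ(∑ μ_k a_k), ψ(∏_k θ_{kh}^{μ_k}))` of `exists_wordValue`. [folklore] -/
theorem sig_eq_pt {K : Type*} [Field K] {l : ℕ} (ψ : K →+* ℂ) (a : Fin l → K)
    (θK : Fin l → Fin N → K) (hθ : ∀ k h, θK k h ≠ 0) (z : Fin N → Fin l → ℂ)
    (hz : ∀ h k, cexp (z h k) = ψ (θK k h)) (μ : Fin l → ℕ) :
    sig (fun k => ψ (a k)) z (fun k => (μ k : ℤ)) =
      ((Multiplicative.ofAdd (ψ (∑ i, (μ i : K) * a i)), fun j' =>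
          Units.mk0 (ψ (∏ i, θK i j' ^ μ i))
            ((map_ne_zero ψ).mpr (Finset.prod_ne_zero_iff.mpr fun i _ => pow_ne_zero _ (hθ i j')))) :
        GaGm N) := by
  ext j'
  · simp [sig, wv, GaGm.exp, map_sum]
  · simp only [sig, wv, GaGm.exp, Units.val_mk0, Int.cast_natCast, map_prod, map_pow]
    rw [Complex.exp_sum]
    refine Finset.prod_congr rfl fun k _ => ?_
    rw [← hz j' k, ← Complex.exp_nat_mul]

/-! ### The auxiliary polynomial `P = ∑ p(k, κ) X^k Y^κ` and the function `F(u) = P(exp_G(Φ u))` -/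

section AuxPoly

variable {KX D₁ : ℕ}

/-- The exponent of the unknown `λ = (k, κ)`: `X^k Y^κ`. (Written with `Finsupp.equivFunOnFinite`;
no definition.) Its additive exponent is `k`. [folklore] -/
theorem expnt_zero (lam : Fin KX × (Fin N → Fin D₁)) :
    (Finsupp.equivFunOnFinite.symm (Fin.cons (lam.1 : ℕ) fun j => (lam.2 j : ℕ)) : Fin (N + 1) →₀ ℕ) 0 =
      (lam.1 : ℕ) := by
  simp

/-- Its torus exponents are `κ`. [folklore] -/
theorem expnt_succ (lam : Fin KX × (Fin N → Fin D₁)) (j : Fin N) :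
    (Finsupp.equivFunOnFinite.symm (Fin.cons (lam.1 : ℕ) fun j => (lam.2 j : ℕ)) : Fin (N + 1) →₀ ℕ)
      j.succ = (lam.2 j : ℕ) := by
  simp

/-- `λ ↦ X^k Y^κ` is injective on exponents. [folklore] -/
theorem expnt_injective :
    Function.Injective fun lam : Fin KX × (Fin N → Fin D₁) =>
      (Finsupp.equivFunOnFinite.symm (Fin.cons (lam.1 : ℕ) fun j => (lam.2 j : ℕ)) : Fin (N + 1) →₀ ℕ) := by
  intro l l' h
  have h0 := congrArg (fun f : Fin (N + 1) →₀ ℕ => f 0) h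
  have hs := fun j => congrArg (fun f : Fin (N + 1) →₀ ℕ => f (Fin.succ j)) h
  simp only [expnt_zero, expnt_succ] at h0 hs
  exact Prod.ext (Fin.ext h0) (funext fun j => Fin.ext (hs j))

/-- The coefficient of `X^k Y^κ` in `P` is `p(k, κ)`. [folklore] -/
theorem coeff_auxPoly (coef : Fin KX × (Fin N → Fin D₁) → ℤ) (lam : Fin KX × (Fin N → Fin D₁)) :
    (∑ l, monomial (Finsupp.equivFunOnFinite.symm (Fin.cons (l.1 : ℕ) fun j => (l.2 j : ℕ)))
        ((coef l : ℤ) : ℂ)).coeff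
        (Finsupp.equivFunOnFinite.symm (Fin.cons (lam.1 : ℕ) fun j => (lam.2 j : ℕ))) = (coef lam : ℂ) := by
  classical
  simp only [MvPolynomial.coeff_sum, MvPolynomial.coeff_monomial]
  rw [Finset.sum_eq_single lam]
  · simp
  · intro b _ hb
    rw [if_neg]
    exact fun h => hb (expnt_injective h)
  · intro h
    exact absurd (Finset.mem_univ lam) h

/-- `P ≠ 0` as soon as some `p(k, κ) ≠ 0`. [folklore] -/
theorem auxPoly_ne_zero (coef : Fin KX × (Fin N → Fin D₁) → ℤ) (hp : coef ≠ 0) :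
    (∑ l, monomial (Finsupp.equivFunOnFinite.symm (Fin.cons (l.1 : ℕ) fun j => (l.2 j : ℕ)))
        ((coef l : ℤ) : ℂ) : MvPolynomial (Fin (N + 1)) ℂ) ≠ 0 := by
  intro h
  apply hp
  funext lam
  have := coeff_auxPoly coef lam
  rw [h, MvPolynomial.coeff_zero] at this
  exact_mod_cast this.symm

/-- The support of `P` consists of exponents `X^k Y^κ`, `k < KX`, `κ_j < D₁`. [folklore] -/
theorem support_auxPoly (coef : Fin KX × (Fin N → Fin D₁) → ℤ) {s : Fin (N + 1) →₀ ℕ}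
    (hs : s ∈ (∑ l, monomial (Finsupp.equivFunOnFinite.symm (Fin.cons (l.1 : ℕ) fun j => (l.2 j : ℕ)))
        ((coef l : ℤ) : ℂ) : MvPolynomial (Fin (N + 1)) ℂ).support) :
    ∃ lam : Fin KX × (Fin N → Fin D₁),
      s = Finsupp.equivFunOnFinite.symm (Fin.cons (lam.1 : ℕ) fun j => (lam.2 j : ℕ)) := by
  classical
  by_contra hne
  push Not at hne
  rw [MvPolynomial.mem_support_iff, MvPolynomial.coeff_sum] at hs
  apply hs
  refine Finset.sum_eq_zero fun l _ => ?_
  rw [MvPolynomial.coeff_monomial, if_neg]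
  exact fun h => hne l h.symm

/-- `deg_X P ≤ KX - 1`. [folklore] -/
theorem degreeOf_zero_auxPoly (coef : Fin KX × (Fin N → Fin D₁) → ℤ) :
    (∑ l, monomial (Finsupp.equivFunOnFinite.symm (Fin.cons (l.1 : ℕ) fun j => (l.2 j : ℕ)))
        ((coef l : ℤ) : ℂ) : MvPolynomial (Fin (N + 1)) ℂ).degreeOf 0 ≤ KX - 1 := by
  classical
  rw [MvPolynomial.degreeOf_le_iff]
  intro s hs
  obtain ⟨lam, rfl⟩ := support_auxPoly coef hs
  rw [expnt_zero]
  have := lam.1.isLt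
  omega

/-- `deg_{Y_j} P ≤ D₁ - 1`. [folklore] -/
theorem degreeOf_succ_auxPoly (coef : Fin KX × (Fin N → Fin D₁) → ℤ) (j : Fin N) :
    (∑ l, monomial (Finsupp.equivFunOnFinite.symm (Fin.cons (l.1 : ℕ) fun j => (l.2 j : ℕ)))
        ((coef l : ℤ) : ℂ) : MvPolynomial (Fin (N + 1)) ℂ).degreeOf j.succ ≤ D₁ - 1 := by
  classical
  rw [MvPolynomial.degreeOf_le_iff]
  intro s hs
  obtain ⟨lam, rfl⟩ := support_auxPoly coef hs
  rw [expnt_succ]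
  have := (lam.2 j).isLt
  omega

end AuxPoly

/-! ### The analytic parametrisation of `V` -/

section Analytic

variable {m : ℕ} (V : Submodule ℂ (ℂ × (Fin N → ℂ))) (bV : Basis (Fin (m + 1)) ℂ V)

/-- **Monomials along the parametrisation** `Φ(u) = ∑ uᵢ bᵢ` of `V` by a basis adapted to the
additive coordinate (`b₀.1 = 1`, `bᵢ.1 = 0` for `i ≠ 0`):
`(c X^s)(exp_G Φ(u)) = c · u₀^{s₀} · e^{⟨w_s, u⟩}`, `w_{s,i} = ∑ⱼ s_{j+1} bᵢ.2ⱼ`. [folklore] -/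
theorem evalAt_monomial_exp_param (hb0 : ((bV 0 : V) : ℂ × (Fin N → ℂ)).1 = 1)
    (hbi : ∀ i, i ≠ 0 → ((bV i : V) : ℂ × (Fin N → ℂ)).1 = 0)
    (s : Fin (N + 1) →₀ ℕ) (c : ℂ) (u : Fin (m + 1) → ℂ) :
    evalAt (monomial s c) (GaGm.exp (∑ i, u i • ((bV i : V) : ℂ × (Fin N → ℂ)))) =
      c * (u 0 ^ (s 0) *
        cexp ((fun i => ∑ j : Fin N, (s j.succ : ℂ) * ((bV i : V) : ℂ × (Fin N → ℂ)).2 j) ⬝ᵥ u)) := by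
  set w : ℂ × (Fin N → ℂ) := ∑ i, u i • ((bV i : V) : ℂ × (Fin N → ℂ)) with hw
  have hw1 : w.1 = u 0 := by
    rw [hw, Prod.fst_sum, Finset.sum_eq_single 0]
    · simp [hb0]
    · intro i _ hi; simp [hbi i hi]
    · intro h; exact absurd (Finset.mem_univ 0) h
  have hw2 : ∀ j, w.2 j = ∑ i, u i * ((bV i : V) : ℂ × (Fin N → ℂ)).2 j := fun j => by
    rw [hw, Prod.snd_sum, Finset.sum_apply]
    simp [smul_eq_mul]
  rw [evalAt, eval_monomial, Finsupp.prod_fintype _ _ (fun i => by rw [pow_zero]), Fin.prod_univ_succ,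
    coord_exp]
  simp only [Fin.cons_zero, Fin.cons_succ, hw1]
  have hprod : ∏ j : Fin N, cexp (w.2 j) ^ (s j.succ) =
      cexp ((fun i => ∑ j : Fin N, (s j.succ : ℂ) * ((bV i : V) : ℂ × (Fin N → ℂ)).2 j) ⬝ᵥ u) := by
    simp_rw [← Complex.exp_nat_mul]
    rw [← Complex.exp_sum]
    congr 1
    simp_rw [hw2, dotProduct, Finset.mul_sum, Finset.sum_mul]
    rw [Finset.sum_comm]
    refine Finset.sum_congr rfl fun i _ => Finset.sum_congr rfl fun j _ => ?_
    ring
  rw [hprod]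

/-- **The function `F(u) = P(exp_G Φ(u))`** is the exponential–polynomial sum of part I.
[folklore] -/
theorem evalAt_auxPoly_exp_param (hb0 : ((bV 0 : V) : ℂ × (Fin N → ℂ)).1 = 1)
    (hbi : ∀ i, i ≠ 0 → ((bV i : V) : ℂ × (Fin N → ℂ)).1 = 0) {KX D₁ : ℕ}
    (coef : Fin KX × (Fin N → Fin D₁) → ℤ) (u : Fin (m + 1) → ℂ) :
    evalAt (∑ l, monomial (Finsupp.equivFunOnFinite.symm (Fin.cons (l.1 : ℕ) fun j => (l.2 j : ℕ)))
        ((coef l : ℤ) : ℂ) : MvPolynomial (Fin (N + 1)) ℂ)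
        (GaGm.exp (∑ i, u i • ((bV i : V) : ℂ × (Fin N → ℂ)))) =
      ∑ l : Fin KX × (Fin N → Fin D₁), ((coef l : ℤ) : ℂ) * (u 0 ^ (l.1 : ℕ) *
        cexp ((fun i => ∑ j : Fin N, ((l.2 j : ℕ) : ℂ) * ((bV i : V) : ℂ × (Fin N → ℂ)).2 j) ⬝ᵥ u)) := by
  rw [evalAt, map_sum]
  refine Finset.sum_congr rfl fun l _ => ?_
  rw [← evalAt, evalAt_monomial_exp_param V bV hb0 hbi]
  simp

/-- **Covering**: every `v ∈ V` is `Φ(u)` with `‖u‖ ≤ C ‖v‖` (`u` = coordinates in the basis, `C`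
the operator norm of the coordinate map). [folklore] -/
theorem exists_param_bound :
    ∃ C : ℝ, 1 ≤ C ∧ ∀ v ∈ V, ∃ u : Fin (m + 1) → ℂ,
      (∑ i, u i • ((bV i : V) : ℂ × (Fin N → ℂ))) = v ∧ ‖u‖ ≤ C * ‖v‖ := by
  let f : V →L[ℂ] (Fin (m + 1) → ℂ) := LinearMap.toContinuousLinearMap bV.equivFun.toLinearMap
  refine ⟨max 1 ‖f‖, le_max_left _ _, fun v hv => ⟨bV.equivFun ⟨v, hv⟩, ?_, ?_⟩⟩
  · have h := bV.sum_equivFun ⟨v, hv⟩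
    have h' := congrArg (fun x : V => (x : ℂ × (Fin N → ℂ))) h
    simpa only [Submodule.coe_sum, Submodule.coe_smul] using h'
  · calc ‖bV.equivFun ⟨v, hv⟩‖ = ‖f ⟨v, hv⟩‖ := rfl
      _ ≤ ‖f‖ * ‖(⟨v, hv⟩ : V)‖ := f.le_opNorm _
      _ ≤ max 1 ‖f‖ * ‖v‖ :=
          mul_le_mul_of_nonneg_right (le_max_right _ _) (norm_nonneg _)

/-- Frequencies: `‖w_{s,i}‖ ≤ (∑ⱼ s_{j+1}) · B` if all `‖bᵢ.2ⱼ‖ ≤ B`. [folklore] -/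
theorem norm_freq_le {B : ℝ} (hB : ∀ i j, ‖((bV i : V) : ℂ × (Fin N → ℂ)).2 j‖ ≤ B)
    (s : Fin (N + 1) →₀ ℕ) (i : Fin (m + 1)) :
    ‖∑ j : Fin N, (s j.succ : ℂ) * ((bV i : V) : ℂ × (Fin N → ℂ)).2 j‖ ≤ (∑ j : Fin N, (s j.succ : ℝ)) * B := by
  rw [Finset.sum_mul]
  refine (norm_sum_le _ _).trans (Finset.sum_le_sum fun j _ => ?_)
  rw [norm_mul, Complex.norm_natCast]
  exact mul_le_mul_of_nonneg_left (hB i j) (Nat.cast_nonneg _)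

end Analytic

/-! ### The size of the points of the box -/

/-- `‖∑ μ_k y_k‖ ≤ S' · (∑_k ‖θ_k‖ + ∑_{h,k} ‖z_{hk}‖)` for `0 ≤ μ_k ≤ S'`. [folklore] -/
theorem norm_wv_le {l : ℕ} (θ : Fin l → ℂ) (z : Fin N → Fin l → ℂ) (μ : Fin l → ℕ) {S' : ℕ}
    (hμ : ∀ k, μ k ≤ S') :
    ‖wv θ z (fun k => (μ k : ℤ))‖ ≤ S' * (∑ k, ‖θ k‖ + ∑ h, ∑ k, ‖z h k‖) := by
  have hS : (0 : ℝ) ≤ S' := Nat.cast_nonneg _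
  have h1 : ‖∑ k, ((μ k : ℤ) : ℂ) * θ k‖ ≤ S' * ∑ k, ‖θ k‖ := by
    rw [Finset.mul_sum]
    refine (norm_sum_le _ _).trans (Finset.sum_le_sum fun k _ => ?_)
    rw [norm_mul, Int.cast_natCast, Complex.norm_natCast]
    exact mul_le_mul_of_nonneg_right (by exact_mod_cast hμ k) (norm_nonneg _)
  have h2 : ∀ h, ‖∑ k, ((μ k : ℤ) : ℂ) * z h k‖ ≤ S' * ∑ k, ‖z h k‖ := fun h => by
    rw [Finset.mul_sum]
    refine (norm_sum_le _ _).trans (Finset.sum_le_sum fun k _ => ?_)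
    rw [norm_mul, Int.cast_natCast, Complex.norm_natCast]
    exact mul_le_mul_of_nonneg_right (by exact_mod_cast hμ k) (norm_nonneg _)
  rw [wv, Prod.norm_def, max_le_iff]
  constructor
  · refine h1.trans ?_
    rw [mul_add]
    exact le_add_of_nonneg_right (by positivity)
  · refine (pi_norm_le_iff_of_nonneg (by positivity)).mpr fun h => (h2 h).trans ?_
    rw [mul_add]
    refine le_add_of_nonneg_of_le (by positivity) ?_
    refine mul_le_mul_of_nonneg_left ?_ hS
    exact Finset.single_le_sum (f := fun h => ∑ k, ‖z h k‖) (fun h _ => by positivity) (Finset.mem_univ h)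

/-! ### Vanishing of the jets from smallness (parts II and III) -/

/-- `e < c⁻¹` from `e · c < 1` (`c > 0`). [folklore] -/
theorem lt_inv_of_mul_lt_one' {e c : ℝ} (hc : 0 < c) (h : e * c < 1) : e < c⁻¹ :=
  lt_of_mul_lt_mul_right (by rwa [inv_mul_cancel₀ hc.ne']) hc.le

/-- **Vanishing along `W` at the points of the box, from smallness on `V`.** In the arithmetic
situation (generators `y_k = (σ(a_k), (z_{hk})_h)`, `e^{z_{hk}} = σ(θ_{kh})`, letters `e_l = σ(ε_l)`,
denominator `b`), if `P = ∑ p(k,κ) X^k Y^κ` (`|p| ≤ P_b`, `k < KX`, `κ_j < D₁`) satisfies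
`|P(exp_G v)| ≤ e^{-U}` for `v ∈ V`, `‖v‖ ≤ S'C_y + E` (`V ∋ y_k, e_l`), and the Liouville budget
`e^{-U} T₀^j b^{(j + KX + ℓS'(N D₁))d} M_j^{d-1} < 1` holds for `j < T₀`, then `P` vanishes to order
`≥ T₀` along `exp_G(W)`, `W = span(e_l)`, at every `σ(μ)`, `0 ≤ μ_k ≤ S'` (parts II and III:
`norm_evalAt_wordDeriv_le`, `wordValue_eq_zero_of_small`). [cite: Waldschmidt1988, §6 Prop. 6.1] -/
theorem vanishesToOrder_of_small {K : Type*} [Field K] [NumberField K] (σ : K →+* ℂ)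
    {n l t : ℕ} (a : Fin l → K) (θK : Fin l → Fin (n + 1) → K) (hθ : ∀ k h, θK k h ≠ 0)
    (z : Fin (n + 1) → Fin l → ℂ) (hz : ∀ h k, cexp (z h k) = σ (θK k h))
    (εK : Fin t → K × (Fin (n + 1) → K))
    (V : Submodule ℂ (ℂ × (Fin (n + 1) → ℂ)))
    (hyV : ∀ k, ((σ (a k), fun h => z h k) : ℂ × (Fin (n + 1) → ℂ)) ∈ V)
    (heV : ∀ l', ((σ (εK l').1, fun h => σ ((εK l').2 h)) : ℂ × (Fin (n + 1) → ℂ)) ∈ V)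
    {b : ℕ} (hb : 1 ≤ b) (ha : ∀ k, IsIntegral ℤ ((b : K) * a k))
    (hθb : ∀ k h, IsIntegral ℤ ((b : K) * θK k h))
    (hε : ∀ l', IsIntegral ℤ ((b : K) * (εK l').1) ∧ ∀ h, IsIntegral ℤ ((b : K) * (εK l').2 h))
    {KX D₁ T₀ S' Pb : ℕ} (hT₀ : 1 ≤ T₀) (p : Fin KX × (Fin (n + 1) → Fin D₁) → ℤ)
    (hpB : ∀ lam, |p lam| ≤ Pb) {U E EK A Θ : ℝ} (hE0 : 0 ≤ E)
    (heE : ∀ l', ‖((σ (εK l').1, fun h => σ ((εK l').2 h)) : ℂ × (Fin (n + 1) → ℂ))‖ ≤ E)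
    (hEK0 : 0 ≤ EK) (hA0 : 0 ≤ A) (hΘ1 : 1 ≤ Θ)
    (hEψ : ∀ (ψ : K →+* ℂ) l', ‖ψ (εK l').1‖ ≤ EK ∧ ∀ h, ‖ψ ((εK l').2 h)‖ ≤ EK)
    (hAψ : ∀ (ψ : K →+* ℂ) k, ‖ψ (a k)‖ ≤ A) (hΘψ : ∀ (ψ : K →+* ℂ) k h, ‖ψ (θK k h)‖ ≤ Θ)
    (hsup : ∀ v ∈ V, ‖v‖ ≤ (S' : ℝ) * (∑ k, ‖σ (a k)‖ + ∑ h, ∑ k, ‖z h k‖) + E →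
      ‖evalAt (∑ lam : Fin KX × (Fin (n + 1) → Fin D₁),
          monomial (Finsupp.equivFunOnFinite.symm (Fin.cons (lam.1 : ℕ) fun j => (lam.2 j : ℕ)))
            ((p lam : ℤ) : ℂ)) (GaGm.exp v)‖ ≤ Real.exp (-U))
    (hbudget : ∀ j < T₀, Real.exp (-U) * (T₀ : ℝ) ^ j *
      (((b : ℝ) ^ (j + KX + l * S' * ((n + 1) * D₁))) ^ Module.finrank ℚ K *
        (max 1 ((KX * D₁ ^ (n + 1) : ℕ) * Pb * (KX * ((((KX : ℝ) + ((n + 1) * D₁ : ℕ)) * EK) ^ j *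
          (((l : ℝ) * S' * A + 1) ^ KX * Θ ^ (l * S' * ((n + 1) * D₁))))))) ^ (Module.finrank ℚ K - 1)) < 1)
    (μ : Fin l → ℕ) (hμ : ∀ k, μ k ≤ S') :
    VanishesToOrder (∑ lam : Fin KX × (Fin (n + 1) → Fin D₁),
        monomial (Finsupp.equivFunOnFinite.symm (Fin.cons (lam.1 : ℕ) fun j => (lam.2 j : ℕ)))
          ((p lam : ℤ) : ℂ))
      (Submodule.span ℂ (Set.range fun l' => ((σ (εK l').1, fun h => σ ((εK l').2 h)) : ℂ × (Fin (n + 1) → ℂ))))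
      (sig (fun k => σ (a k)) z fun k => (μ k : ℤ)) T₀ := by
  classical
  set P : MvPolynomial (Fin (n + 1 + 1)) ℂ := ∑ lam : Fin KX × (Fin (n + 1) → Fin D₁),
    monomial (Finsupp.equivFunOnFinite.symm (Fin.cons (lam.1 : ℕ) fun j => (lam.2 j : ℕ)))
      ((p lam : ℤ) : ℂ) with hP
  set eC : Fin t → ℂ × (Fin (n + 1) → ℂ) := fun l' => ((σ (εK l').1, fun h => σ ((εK l').2 h))) with heC
  set Cy : ℝ := ∑ k, ‖σ (a k)‖ + ∑ h, ∑ k, ‖z h k‖ with hCy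
  -- the point `y = ∑ μ_k y_k ∈ V`
  set y : ℂ × (Fin (n + 1) → ℂ) := wv (fun k => σ (a k)) z (fun k => (μ k : ℤ)) with hy
  have hyV' : y ∈ V := by
    have : y = ∑ k, ((μ k : ℤ) : ℂ) • ((σ (a k), fun h => z h k) : ℂ × (Fin (n + 1) → ℂ)) := by
      rw [hy, wv]; ext <;> simp [Finset.sum_apply, Prod.fst_sum, Prod.snd_sum, smul_eq_mul]
    rw [this]
    exact V.sum_mem fun k _ => V.smul_mem _ (hyV k)
  have hynorm : ‖y‖ ≤ (S' : ℝ) * Cy := norm_wv_le _ _ μ hμ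
  have hsig : sig (fun k => σ (a k)) z (fun k => (μ k : ℤ)) = (1 : GaGm (n + 1)) * GaGm.exp y := by
    rw [one_mul]; rfl
  -- part II: the words are small
  have hT₀pos : (0 : ℝ) < T₀ := by exact_mod_cast hT₀
  have hsmallw : ∀ {j : ℕ} (wd : Fin j → Fin t), j < T₀ →
      ‖evalAt (wordDeriv (fun i => eC (wd i)) P) ((1 : GaGm (n + 1)) * GaGm.exp y)‖ ≤
        Real.exp (-U) * (T₀ : ℝ) ^ j := by
    intro j wd hj
    have h := norm_evalAt_wordDeriv_le P (1 : GaGm (n + 1)) V (R' := (S' : ℝ) * Cy + E)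
      (B := Real.exp (-U)) (E := E) (r := 1 / (T₀ : ℝ)) (by positivity)
      (fun v hv hvR => by rw [one_mul]; exact hsup v hv hvR)
      (fun i => eC (wd i)) (fun i => heV (wd i)) (fun i => heE (wd i)) y hyV' (by
        have hjle : (j : ℝ) * (1 / (T₀ : ℝ) * E) ≤ E := by
          rw [show (j : ℝ) * (1 / (T₀ : ℝ) * E) = ((j : ℝ) / T₀) * E by ring]
          have : (j : ℝ) / T₀ ≤ 1 := by
            rw [div_le_one hT₀pos]; exact_mod_cast hj.le
          nlinarith
        linarith)
    calc _ ≤ Real.exp (-U) / (1 / (T₀ : ℝ)) ^ j := h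
      _ = Real.exp (-U) * (T₀ : ℝ) ^ j := by rw [one_div, inv_pow, div_inv_eq_mul]
  -- part III: hence they vanish
  refine vanishesToOrder_of_alphabet eC P _ T₀ fun j hj wd => ?_
  rw [hsig]
  -- the point and the word are those of part III
  have hpt := sig_eq_pt σ a θK hθ z hz μ
  rw [hsig] at hpt
  have hs0 : ∀ lam : Fin KX × (Fin (n + 1) → Fin D₁),
      (Finsupp.equivFunOnFinite.symm (Fin.cons (lam.1 : ℕ) fun j => (lam.2 j : ℕ)) : Fin (n + 1 + 1) →₀ ℕ) 0 < KX :=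
    fun lam => by rw [expnt_zero]; exact lam.1.isLt
  have hs1 : ∀ lam : Fin KX × (Fin (n + 1) → Fin D₁),
      ∑ h' : Fin (n + 1), (Finsupp.equivFunOnFinite.symm (Fin.cons (lam.1 : ℕ) fun j => (lam.2 j : ℕ)) :
        Fin (n + 1 + 1) →₀ ℕ) h'.succ ≤ (n + 1) * D₁ := fun lam => by
    calc _ = ∑ h' : Fin (n + 1), (lam.2 h' : ℕ) := Finset.sum_congr rfl fun h' _ => expnt_succ lam h'
      _ ≤ ∑ _h' : Fin (n + 1), D₁ := Finset.sum_le_sum fun h' _ => (lam.2 h').isLt.le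
      _ = (n + 1) * D₁ := by simp
  have key := wordValue_eq_zero_of_small σ a θK hθ μ hμ (fun lam : Fin KX × (Fin (n + 1) → Fin D₁) =>
      (Finsupp.equivFunOnFinite.symm (Fin.cons (lam.1 : ℕ) fun j => (lam.2 j : ℕ)) : Fin (n + 1 + 1) →₀ ℕ))
    hs0 hs1 p hpB (fun i => εK (wd i)) hb ha hθb (fun i => hε (wd i)) hEK0 hA0 hΘ1
    (fun ψ i => hEψ ψ (wd i)) hAψ hΘψ ?_
  · rw [hpt]; exact key
  -- the smallness hypothesis of part III
  rw [← hpt]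
  refine lt_of_le_of_lt (hsmallw wd hj) (lt_inv_of_mul_lt_one' (by positivity) ?_)
  have hcard : (Fintype.card (Fin KX × (Fin (n + 1) → Fin D₁)) : ℝ) = ((KX * D₁ ^ (n + 1) : ℕ) : ℝ) := by
    simp [Fintype.card_prod, Fintype.card_pi, Finset.prod_const, Finset.card_univ]
  have := hbudget j hj
  simp only [Fintype.card_fin] at this ⊢
  rw [hcard]
  convert this using 3

/-! ### Crude bounds by sums -/

/-- `f i ≤ ∑ f + 1` for non-negative `f`. [folklore] -/
theorem le_sum_add_one {ι : Type*} [Fintype ι] (f : ι → ℝ) (hf : ∀ i, 0 ≤ f i) (i : ι) :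
    f i ≤ ∑ j, f j + 1 := by
  have := Finset.single_le_sum (f := f) (fun j _ => hf j) (Finset.mem_univ i)
  linarith

/-- `1 ≤ ∑ f + 1` for non-negative `f`. [folklore] -/
theorem one_le_sum_add_one {ι : Type*} [Fintype ι] (f : ι → ℝ) (hf : ∀ i, 0 ≤ f i) :
    1 ≤ ∑ j, f j + 1 := by
  have := Finset.sum_nonneg (s := Finset.univ) fun j (_ : j ∈ Finset.univ) => hf j
  linarith

/-- `f i j ≤ ∑∑ f + 1` for non-negative `f`. [folklore] -/
theorem le_sum_sum_add_one {ι κ : Type*} [Fintype ι] [Fintype κ] (f : ι → κ → ℝ) (hf : ∀ i j, 0 ≤ f i j)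
    (i : ι) (j : κ) : f i j ≤ ∑ i', ∑ j', f i' j' + 1 := by
  have h1 := Finset.single_le_sum (f := fun j' => f i j') (fun j' _ => hf i j') (Finset.mem_univ j)
  have h2 := Finset.single_le_sum (f := fun i' => ∑ j', f i' j') (fun i' _ => Finset.sum_nonneg fun j' _ => hf i' j')
    (Finset.mem_univ i)
  linarith

/-- `f i ≤ ∑ f` for non-negative `f`. [folklore] -/
theorem le_sum' {ι : Type*} [Fintype ι] (f : ι → ℝ) (hf : ∀ i, 0 ≤ f i) (i : ι) : f i ≤ ∑ j, f j :=
  Finset.single_le_sum (f := f) (fun j _ => hf j) (Finset.mem_univ i)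


/-! ### The construction -/

set_option maxHeartbeats 4000000 in
/-- **The auxiliary polynomials of the linear subgroup theorem on `𝔾ₐ × 𝔾ₘ^N`** (the hypothesis of
`linearSubgroup_of_vanishing`, [Waldschmidt1988, Prop. 6.1 + Liouville]): in the arithmetic situation,
for all large `S` there is a non-zero `P` with `deg_X P ≤ S^N L`, `deg_{Y_j} P ≤ S^{N-1} L⁴`
(`L = log₂ S + 1`) vanishing to order `≥ (N+1) S^N L² + 1` along `exp_G(W)` at all `σ(μ)`,
`0 ≤ μ_k ≤ (N+1)S`. [cite: Waldschmidt1988, §6 Prop. 6.1] -/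
theorem exists_auxiliaryPolynomial {K : Type*} [Field K] [NumberField K] (σ : K →+* ℂ)
    {n l t m' : ℕ} (hm : m' ≤ n)
    (a : Fin l → K) (θK : Fin l → Fin (n + 1) → K) (hθ : ∀ k h, θK k h ≠ 0)
    (z : Fin (n + 1) → Fin l → ℂ) (hz : ∀ h k, cexp (z h k) = σ (θK k h))
    (εK : Fin t → K × (Fin (n + 1) → K))
    (V : Submodule ℂ (ℂ × (Fin (n + 1) → ℂ))) (bV : Basis (Fin (m' + 1)) ℂ V)
    (hb0 : ((bV 0 : V) : ℂ × (Fin (n + 1) → ℂ)).1 = 1)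
    (hbi : ∀ i, i ≠ 0 → ((bV i : V) : ℂ × (Fin (n + 1) → ℂ)).1 = 0)
    (hyV : ∀ k, ((σ (a k), fun h => z h k) : ℂ × (Fin (n + 1) → ℂ)) ∈ V)
    (heV : ∀ l', ((σ (εK l').1, fun h => σ ((εK l').2 h)) : ℂ × (Fin (n + 1) → ℂ)) ∈ V)
    {b : ℕ} (hb : 1 ≤ b) (ha : ∀ k, IsIntegral ℤ ((b : K) * a k))
    (hθb : ∀ k h, IsIntegral ℤ ((b : K) * θK k h))
    (hε : ∀ l', IsIntegral ℤ ((b : K) * (εK l').1) ∧ ∀ h, IsIntegral ℤ ((b : K) * (εK l').2 h)) :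
    ∀ᶠ S in atTop, ∃ P : MvPolynomial (Fin (n + 1 + 1)) ℂ, P ≠ 0 ∧
        P.degreeOf 0 ≤ S ^ (n + 1) * (Nat.log 2 S + 1) ∧
        (∀ j : Fin (n + 1), P.degreeOf j.succ ≤ 1 * S ^ (n + 1 - 1) * (Nat.log 2 S + 1) ^ 4) ∧
        ∀ μ : Fin l → ℕ, (∀ k, μ k ≤ (n + 1 + 1) * S) →
          VanishesToOrder P (Submodule.span ℂ (Set.range fun l' =>
              ((σ (εK l').1, fun h => σ ((εK l').2 h)) : ℂ × (Fin (n + 1) → ℂ))))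
            (sig (fun k => σ (a k)) z fun k => (μ k : ℤ))
            ((n + 1 + 1) * (S ^ (n + 1) * (Nat.log 2 S + 1) ^ 2) + 1) := by
  classical
  -- the real constants of the data
  obtain ⟨CΨ, hCΨ1, hcover⟩ := exists_param_bound V bV
  set Cy : ℝ := ∑ k, ‖σ (a k)‖ + ∑ h, ∑ k, ‖z h k‖ with hCy
  have hCy0 : 0 ≤ Cy := by positivity
  set E : ℝ := ∑ l', ‖((σ (εK l').1, fun h => σ ((εK l').2 h)) : ℂ × (Fin (n + 1) → ℂ))‖ + 1 with hE
  have hE1 : 1 ≤ E := one_le_sum_add_one _ fun _ => norm_nonneg _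
  have heE : ∀ l', ‖((σ (εK l').1, fun h => σ ((εK l').2 h)) : ℂ × (Fin (n + 1) → ℂ))‖ ≤ E :=
    le_sum_add_one (fun l' => ‖((σ (εK l').1, fun h => σ ((εK l').2 h)) : ℂ × (Fin (n + 1) → ℂ))‖)
      fun _ => norm_nonneg _
  set BΦ : ℝ := ∑ i, ∑ j, ‖((bV i : V) : ℂ × (Fin (n + 1) → ℂ)).2 j‖ + 1 with hBΦ
  have hBΦ1 : 1 ≤ BΦ := one_le_sum_add_one _ fun _ => Finset.sum_nonneg fun _ _ => norm_nonneg _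
  have hbB : ∀ i j, ‖((bV i : V) : ℂ × (Fin (n + 1) → ℂ)).2 j‖ ≤ BΦ :=
    le_sum_sum_add_one (fun i j => ‖((bV i : V) : ℂ × (Fin (n + 1) → ℂ)).2 j‖) fun _ _ => norm_nonneg _
  set EK : ℝ := ∑ l', (NumberField.house (εK l').1 + ∑ h, NumberField.house ((εK l').2 h)) + 1 with hEK
  have hhouse0 : ∀ x : K, 0 ≤ NumberField.house x := fun x => NumberField.house_nonneg x
  have hEKi : ∀ l', NumberField.house (εK l').1 + ∑ h, NumberField.house ((εK l').2 h) ≤ EK :=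
    le_sum_add_one (fun l' => NumberField.house (εK l').1 + ∑ h, NumberField.house ((εK l').2 h))
      fun l' => add_nonneg (hhouse0 _) (Finset.sum_nonneg fun _ _ => hhouse0 _)
  have hEK1 : 1 ≤ EK := one_le_sum_add_one _ fun l' => add_nonneg (hhouse0 _) (Finset.sum_nonneg fun _ _ => hhouse0 _)
  have hEψ : ∀ (ψ : K →+* ℂ) l', ‖ψ (εK l').1‖ ≤ EK ∧ ∀ h, ‖ψ ((εK l').2 h)‖ ≤ EK := by
    intro ψ l'
    have hl := hEKi l'
    have hs0 : 0 ≤ ∑ h, NumberField.house ((εK l').2 h) := Finset.sum_nonneg fun _ _ => hhouse0 _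
    refine ⟨?_, fun h => ?_⟩
    · have := NumberField.norm_embedding_le_house (εK l').1 ψ
      linarith
    · have := NumberField.norm_embedding_le_house ((εK l').2 h) ψ
      have h2 := le_sum' (fun h => NumberField.house ((εK l').2 h)) (fun _ => hhouse0 _) h
      linarith [hhouse0 (εK l').1]
  set A : ℝ := ∑ k, NumberField.house (a k) with hA
  have hA0 : 0 ≤ A := Finset.sum_nonneg fun k _ => hhouse0 _
  have hAψ : ∀ (ψ : K →+* ℂ) k, ‖ψ (a k)‖ ≤ A := fun ψ k =>
    (NumberField.norm_embedding_le_house (a k) ψ).trans (le_sum' (fun k => NumberField.house (a k)) (fun _ => hhouse0 _) k)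
  set Θ : ℝ := ∑ k, ∑ h, NumberField.house (θK k h) + 1 with hΘ
  have hΘ1 : 1 ≤ Θ := one_le_sum_add_one _ fun _ => Finset.sum_nonneg fun _ _ => hhouse0 _
  have hΘψ : ∀ (ψ : K →+* ℂ) k h, ‖ψ (θK k h)‖ ≤ Θ := fun ψ k h =>
    (NumberField.norm_embedding_le_house (θK k h) ψ).trans
      (le_sum_sum_add_one (fun k h => NumberField.house (θK k h)) (fun _ _ => hhouse0 _) k h)
  set d : ℕ := Module.finrank ℚ K with hd
  have hd1 : 1 ≤ d := Module.finrank_pos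
  set cR : ℝ := CΨ * ((n + 2) * Cy + E) + 1 with hcR
  have hcR1 : 1 ≤ cR := by rw [hcR]; nlinarith [mul_nonneg (by linarith : (0:ℝ) ≤ CΨ) (by positivity : (0:ℝ) ≤ (n + 2) * Cy + E)]
  set Cρn : ℕ := ⌈(n + 1) * BΦ * cR⌉₊ + 1 with hCρn
  have hCρn' : (n + 1) * BΦ * cR + 1 ≤ (Cρn : ℝ) := by
    rw [hCρn]; push_cast; linarith [Nat.le_ceil ((n + 1) * BΦ * cR)]
  set cL : ℝ := (d : ℝ) * l * (n + 1) * (n + 2) * (Real.log b + Real.log Θ) with hcL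
  set CU : ℕ := ⌈cL⌉₊ + 2 with hCU
  have hCU' : cL + 2 ≤ (CU : ℝ) := by rw [hCU]; push_cast; linarith [Nat.le_ceil cL]
  set Cρm : ℕ := (m' + 1) * Cρn with hCρm
  set CT1 : ℕ := CU + 8 * Cρm + 5 with hCT1
  set cm : ℕ := 4 * (Cρm + CU + 6) with hcm
  set Cbig1 : ℝ := 2 * (cR + 1) + 8 * ((CT1 : ℝ) + 2) ^ (n + 1) * (cm + 1) +
    ((n + 2) * (n + 1) + 4 * n + 6) + (n + 1) * ((CT1 : ℝ) + n + 7) + 10 with hCbig1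
  set Cbig2 : ℝ := (n + 3) * (2 * n + 6) + (n + 5) * (d : ℝ) * b +
    d * (((n + 2) * (n + 1) + 4 * n + 6) + (2 * cm * ((CT1 : ℝ) + 2) ^ (n + 1) + 1) + (n + 3) +
      (n + 3) * (2 * n + 8 + EK) + 2 * ((l : ℝ) * (n + 2) * A + 2)) with hCbig2
  -- a good `S`
  have hL : Tendsto (fun S : ℕ => ((Nat.log 2 S + 1 : ℕ) : ℝ)) atTop atTop :=
    (tendsto_natCast_atTop_atTop (R := ℝ)).comp tendsto_natLog_two_add_one
  have hev : ∀ᶠ S : ℕ in atTop, 2 ≤ S ∧ Cbig1 ≤ ((Nat.log 2 S + 1 : ℕ) : ℝ) ∧ Cbig2 ≤ ((Nat.log 2 S + 1 : ℕ) : ℝ) :=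
    (eventually_ge_atTop 2).and ((hL.eventually (eventually_ge_atTop Cbig1)).and
      (hL.eventually (eventually_ge_atTop Cbig2)))
  filter_upwards [hev] with S hS
  obtain ⟨hS2, hbig1, hbig2⟩ := hS
  have hS1 : 1 ≤ S := by omega
  have hS1r : (1 : ℝ) ≤ S := by exact_mod_cast hS1
  -- the parameters
  set Lv : ℕ := Nat.log 2 S + 1 with hLv
  have hLv1 : 1 ≤ Lv := by rw [hLv]; omega
  have hLv1r : (1 : ℝ) ≤ Lv := by exact_mod_cast hLv1
  have hlogS : Real.log S ≤ Lv := log_le_natLog_two_add_one S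
  set D₁ : ℕ := S ^ n * Lv ^ 4 with hD₁
  set KX : ℕ := S ^ (n + 1) * Lv + 1 with hKX
  set T₀ : ℕ := (n + 1 + 1) * (S ^ (n + 1) * Lv ^ 2) + 1 with hT₀
  set S' : ℕ := (n + 1 + 1) * S with hS'
  set T₁ : ℕ := CT1 * (S ^ (n + 1) * Lv ^ 4) with hT₁
  set cardΛ : ℕ := KX * D₁ ^ (n + 1) with hcardΛ
  set m₀ : ℕ := cm * (S ^ (n + 1) * Lv ^ 4) with hm₀
  set k₀ : ℕ := 2 ^ m₀ with hk₀
  set m₁ : ℕ := 2 * m₀ * ((KX + T₁) * T₁ ^ m') / cardΛ + 1 with hm₁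
  set Pb : ℕ := 2 ^ m₁ - 1 with hPb
  have hPb1 : Pb + 1 = 2 ^ m₁ := by rw [hPb]; exact Nat.sub_add_cancel Nat.one_le_two_pow
  set R : ℝ := cR * S with hR
  set ρ : ℝ := (n + 1) * D₁ * BΦ * R with hρ
  set U : ℝ := CU * ((S : ℝ) ^ (n + 1) * (Lv : ℝ) ^ 4) with hU
  set Q : ℝ := (S : ℝ) ^ (n + 1) * (Lv : ℝ) ^ 4 with hQ
  have hQ1 : 1 ≤ Q := one_le_mul_of_one_le_of_one_le (one_le_pow₀ hS1r) (one_le_pow₀ hLv1r)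
  -- elementary facts on the parameters
  have hpos1 : (0:ℝ) ≤ 8 * ((CT1 : ℝ) + 2) ^ (n + 1) * (cm + 1) := by positivity
  have hpos2 : (0:ℝ) ≤ (n + 1) * ((CT1 : ℝ) + n + 7) := by positivity
  have hpos3 : (0:ℝ) ≤ (n + 2) * (n + 1) + 4 * (n:ℝ) + 6 := by positivity
  have hB1 : 2 * (cR + 1) ≤ (Lv : ℝ) := by rw [hCbig1] at hbig1; linarith
  obtain ⟨hR1, -⟩ := param_radius (n := n) hS1 hLv1 hlogS hKX hcR1 hR hB1
  obtain ⟨hρ0, hρle⟩ := param_rho (n := n) (S := S) (Lv := Lv) hD₁ hR hρ (by linarith) (by linarith) hCρn'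
  have hD₁pos : 0 < D₁ := by rw [hD₁]; positivity
  have hcardpos : 0 < cardΛ := by rw [hcardΛ, hKX]; positivity
  have hT₁r : (T₁ : ℝ) = CT1 * Q := by rw [hT₁, hQ]; push_cast; ring
  have hT₁1 : 1 ≤ T₁ := by
    rw [hT₁]
    have h1 : 1 ≤ CT1 := by rw [hCT1]; omega
    have h2 : 1 ≤ S ^ (n + 1) * Lv ^ 4 := Nat.mul_le_mul (Nat.one_le_pow _ S (by omega)) (Nat.one_le_pow _ Lv hLv1)
    exact Nat.mul_le_mul h1 h2
  have h8ρ : 8 * ρ ≤ T₁ := by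
    rw [hT₁r]
    have h1 : 8 * (Cρn : ℝ) ≤ CT1 := by
      rw [hCT1, hCρm]; push_cast
      have : (Cρn : ℝ) ≤ ((m' : ℝ) + 1) * Cρn := by nlinarith [show (0:ℝ) ≤ m' * (Cρn:ℝ) by positivity]
      nlinarith [show (0:ℝ) ≤ (CU:ℝ) by positivity]
    have h2 : ρ ≤ (Cρn : ℝ) * Q := hρle.trans (by nlinarith)
    nlinarith
  -- part I: the auxiliary function
  set w : Fin KX × (Fin (n + 1) → Fin D₁) → Fin (m' + 1) → ℂ :=
    fun lam i => ∑ j : Fin (n + 1), ((lam.2 j : ℕ) : ℂ) * ((bV i : V) : ℂ × (Fin (n + 1) → ℂ)).2 j with hw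
  have hwρ : ∀ lam i, ‖w lam i‖ * R ≤ ρ := by
    intro lam i
    have h1 : ‖w lam i‖ ≤ ((n + 1) * D₁ : ℝ) * BΦ := by
      rw [hw]
      calc ‖∑ j : Fin (n + 1), ((lam.2 j : ℕ) : ℂ) * ((bV i : V) : ℂ × (Fin (n + 1) → ℂ)).2 j‖
          ≤ ∑ j : Fin (n + 1), ‖((lam.2 j : ℕ) : ℂ) * ((bV i : V) : ℂ × (Fin (n + 1) → ℂ)).2 j‖ := norm_sum_le _ _
        _ ≤ ∑ _j : Fin (n + 1), (D₁ : ℝ) * BΦ := Finset.sum_le_sum fun j _ => by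
            rw [norm_mul, Complex.norm_natCast]
            exact mul_le_mul (by exact_mod_cast (lam.2 j).isLt.le) (hbB i j) (norm_nonneg _) (Nat.cast_nonneg _)
        _ = ((n + 1) * D₁ : ℝ) * BΦ := by
            rw [Finset.sum_const, Finset.card_univ, Fintype.card_fin, nsmul_eq_mul]; push_cast; ring
    calc ‖w lam i‖ * R ≤ (((n + 1) * D₁ : ℝ) * BΦ) * R := mul_le_mul_of_nonneg_right h1 (by linarith)
      _ = ρ := by rw [hρ]
  have hk₀pos : 0 < k₀ := by rw [hk₀]; positivity
  have hcardeq : Fintype.card (Fin KX × (Fin (n + 1) → Fin D₁)) = cardΛ := by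
    simp [hcardΛ, Fintype.card_prod, Fintype.card_pi, Finset.prod_const, Finset.card_univ]
  have hbox : k₀ ^ (2 * ((KX + T₁) * T₁ ^ m')) < (Pb + 1) ^ Fintype.card (Fin KX × (Fin (n + 1) → Fin D₁)) := by
    rw [hcardeq, hPb1, hk₀, ← pow_mul, ← pow_mul]
    refine Nat.pow_lt_pow_right (by norm_num) ?_
    have := Nat.lt_div_mul_add (a := 2 * m₀ * ((KX + T₁) * T₁ ^ m')) hcardpos
    rw [hm₁]
    nlinarith [this]
  obtain ⟨p, hp0, hpB, hFsmall⟩ := exists_smallValues (Λ := Fin KX × (Fin (n + 1) → Fin D₁)) (n := m')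
    (D₀ := KX) (T := T₁) (fun lam => (lam.1 : ℕ)) (fun lam => lam.1.isLt) w hR1 hρ0 hwρ
    (by exact_mod_cast h8ρ) hT₁1 Pb k₀ hk₀pos hbox
  -- its bound is `≤ e^{-U}`
  have hCT1' : CU + (m' + 1) * Cρn + 5 ≤ CT1 := by rw [hCT1, hCρm]; omega
  have hcm' : 4 * ((m' + 1) * Cρn + CU + 6) ≤ cm := by rw [hcm, hCρm]
  have hbig1' : 2 * (cR + 1) + 8 * ((CT1 : ℝ) + 2) ^ (n + 1) * (cm + 1) + ((n + 2) * (n + 1) + 4 * n + 6)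
      + (n + 1) * ((CT1 : ℝ) + n + 7) + 10 ≤ Lv := by rw [hCbig1] at hbig1; exact hbig1
  have hε₁ := smallness_le_exp_neg (n := n) (m' := m') (S := S) (Lv := Lv) (KX := KX) (D₁ := D₁) (T₁ := T₁)
    (cardΛ := cardΛ) (m₀ := m₀) (k₀ := k₀) (m₁ := m₁) (Pb := Pb) (CU := CU) (Cρn := Cρn) (CT1 := CT1) (cm := cm)
    (R := R) (ρ := ρ) (U := U) (cR := cR) (BΦ := BΦ) hm hS2 hLv1 hlogS hKX hD₁ hT₁ hcardΛ hm₀ hk₀ hm₁ hPb1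
    hcR1 hBΦ1 hR hρ hU hCρn' hCT1' hcm' hbig1'
  rw [hcardeq] at hFsmall
  -- the polynomial
  refine ⟨∑ lam : Fin KX × (Fin (n + 1) → Fin D₁),
      monomial (Finsupp.equivFunOnFinite.symm (Fin.cons (lam.1 : ℕ) fun j => (lam.2 j : ℕ))) ((p lam : ℤ) : ℂ),
    auxPoly_ne_zero p hp0, ?_, fun j => ?_, fun μ hμ => ?_⟩
  · refine (degreeOf_zero_auxPoly p).trans ?_
    rw [hKX, hLv]; omega
  · refine (degreeOf_succ_auxPoly p j).trans ?_
    rw [hD₁, hLv, Nat.add_sub_cancel, one_mul]; omega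
  -- the vanishing (parts II, III)
  have hT₀1 : 1 ≤ T₀ := by rw [hT₀]; omega
  -- smallness on the ball of `V`
  have hsup : ∀ v ∈ V, ‖v‖ ≤ (S' : ℝ) * Cy + E →
      ‖evalAt (∑ lam : Fin KX × (Fin (n + 1) → Fin D₁),
          monomial (Finsupp.equivFunOnFinite.symm (Fin.cons (lam.1 : ℕ) fun j => (lam.2 j : ℕ)))
            ((p lam : ℤ) : ℂ)) (GaGm.exp v)‖ ≤ Real.exp (-U) := by
    intro v hv hvR
    obtain ⟨u, hu, huR⟩ := hcover v hv
    rw [← hu, evalAt_auxPoly_exp_param V bV hb0 hbi p u]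
    refine (hFsmall u ?_).trans hε₁
    have h1 : CΨ * ((S' : ℝ) * Cy + E) ≤ R := by
      rw [hR, hcR, hS']; push_cast
      have hCΨ0 : 0 ≤ CΨ := by linarith
      have hE0 : 0 ≤ E := by linarith
      have key : CΨ * E ≤ CΨ * E * S := le_mul_of_one_le_right (mul_nonneg hCΨ0 hE0) hS1r
      have hSnn : (0:ℝ) ≤ S := by linarith
      have e1 : (CΨ * ((n + 2 : ℝ) * Cy + E) + 1) * (S:ℝ) = CΨ * ((n + 1 + 1 : ℝ) * S * Cy) + CΨ * E * S + S := by ring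
      have e2 : CΨ * ((n + 1 + 1 : ℝ) * S * Cy + E) = CΨ * ((n + 1 + 1 : ℝ) * S * Cy) + CΨ * E := by ring
      rw [e1, e2]; linarith
    calc ‖u‖ ≤ CΨ * ‖v‖ := huR
      _ ≤ CΨ * ((S' : ℝ) * Cy + E) := mul_le_mul_of_nonneg_left hvR (by linarith)
      _ ≤ R := h1
  -- the Liouville budget
  have hm₁le : (m₁ : ℝ) ≤ 2 * cm * ((CT1 : ℝ) + 2) ^ (n + 1) * ((S : ℝ) ^ (n + 1) * (Lv : ℝ) ^ 3) + 1 :=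
    cast_m₁_le hm hS1 hLv1 hKX hD₁ hT₁ rfl hcardΛ hm₀ hm₁
  have hm₁1 : 1 ≤ m₁ := by rw [hm₁]; exact Nat.le_add_left 1 _
  have hbig2' : (n + 3) * (2 * n + 6) + (n + 5) * (d : ℝ) * b +
      d * (((n + 2) * (n + 1) + 4 * n + 6) + (2 * cm * ((CT1 : ℝ) + 2) ^ (n + 1) + 1) + (n + 3) +
        (n + 3) * (2 * n + 8 + EK) + 2 * ((l : ℝ) * (n + 2) * A + 2)) ≤ Lv := by rw [hCbig2] at hbig2; exact hbig2
  have hT₀' : T₀ = (n + 2) * (S ^ (n + 1) * Lv ^ 2) + 1 := by rw [hT₀]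
  have hS'' : S' = (n + 2) * S := by rw [hS']
  obtain ⟨hT₀1r, -, -⟩ := param_T₀ (n := n) hS1 hLv1 hlogS hT₀'
  obtain ⟨hKXD1, -⟩ := param_logKXD (n := n) hS1 hLv1 hlogS hKX hD₁ hEK1
  obtain ⟨hcard1, -⟩ := param_card (n := n) hS1 hLv1 hlogS hKX hD₁ hcardΛ
  obtain ⟨hPb1r, -⟩ := param_Pb hm₁1 hPb1
  have hKX1r : (1 : ℝ) ≤ KX := by
    rw [hKX]; push_cast
    have : (1 : ℝ) ≤ (S : ℝ) ^ (n + 1) * Lv := one_le_mul_of_one_le_of_one_le (one_le_pow₀ hS1r) hLv1r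
    linarith
  have hbudget : ∀ j < T₀, Real.exp (-U) * (T₀ : ℝ) ^ j *
      (((b : ℝ) ^ (j + KX + l * S' * ((n + 1) * D₁))) ^ Module.finrank ℚ K *
        (max 1 ((KX * D₁ ^ (n + 1) : ℕ) * Pb * (KX * ((((KX : ℝ) + ((n + 1) * D₁ : ℕ)) * EK) ^ j *
          (((l : ℝ) * S' * A + 1) ^ KX * Θ ^ (l * S' * ((n + 1) * D₁))))))) ^ (Module.finrank ℚ K - 1)) < 1 := by
    intro j hj
    have hsum := liouville_param (n := n) (S := S) (Lv := Lv) (l := l) (d := d) (b := b) (KX := KX) (D₁ := D₁)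
      (T₀ := T₀) (S' := S') (cardΛ := cardΛ) (Pb := Pb) (m₁ := m₁) (CU := CU) (CT1 := CT1) (cm := cm) (j := j)
      (EK := EK) (A := A) (Θ := Θ) (U := U) hS1 hLv1 hlogS hKX hD₁ hT₀' hS'' hcardΛ hm₁1 hPb1 hm₁le hd1 hb hEK1 hA0 hΘ1
      hU (by rw [← hcL]; exact hCU') hbig2' hj.le
    have hlSA1 : (1 : ℝ) ≤ (l : ℝ) * S' * A + 1 := by linarith only [show (0:ℝ) ≤ (l : ℝ) * S' * A by positivity]
    have hY : (1 : ℝ) ≤ (cardΛ : ℝ) * Pb * (KX * ((((KX : ℝ) + ((n + 1) * D₁ : ℕ)) * EK) ^ j *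
        (((l : ℝ) * S' * A + 1) ^ KX * Θ ^ (l * S' * ((n + 1) * D₁))))) :=
      one_le_mul_of_one_le_of_one_le (one_le_mul_of_one_le_of_one_le hcard1 hPb1r)
        (one_le_mul_of_one_le_of_one_le hKX1r (one_le_mul_of_one_le_of_one_le (one_le_pow₀ hKXD1)
          (one_le_mul_of_one_le_of_one_le (one_le_pow₀ hlSA1) (one_le_pow₀ hΘ1))))
    have := liouville_budget (j := j) (d := d) (e := j + KX + l * S' * ((n + 1) * D₁)) hT₀1r
      (by exact_mod_cast hb : (1:ℝ) ≤ b) hY hsum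
    rw [hcardΛ] at this
    exact this
  exact vanishesToOrder_of_small σ a θK hθ z hz εK V hyV heV hb ha hθb hε hT₀1 p hpB (by linarith) heE
    (by linarith) hA0 hΘ1 hEψ hAψ hΘψ hsup hbudget μ hμ


/-! ### Theorem 4.1 for `𝔾ₐ × 𝔾ₘ^N` -/

/-- **Waldschmidt's linear subgroup theorem on `𝔾ₐ × 𝔾ₘ^N` (hyperplane case, arithmetic form).**
Let `K` be a number field embedded by `σ`, `y_k = (σ(a_k), (z_{hk})_h) ∈ Lie G` with
`e^{z_{hk}} = σ(θ_{kh})` (so `exp_G(∑ℤ y_k) ⊆ G(ℚ̄)`), `W = span(e_l)` with `e_l = σ(ε_l)` (rational over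
`ℚ̄`), `W ≠ 0`, all contained in a subspace `V` of dimension `m'+1 ≤ N` on which the additive
coordinate does not vanish (basis `b` with `b₀.1 = 1`, `bᵢ.1 = 0`). Then there are a connected
algebraic subgroup `G' = V' × T_M ≠ G` and `r` independent relations `ρᵢ ∈ ℤ^ℓ` with
`σ(ρᵢ) = exp_G(∑ ρᵢₖ y_k) ∈ G'` such that `τ < δ` and `(ℓ - r) + δ₁ + Nτ ≤ Nδ`
(`τ = dim W - dim(W ∩ Lie G')`, `δ₁ = N - dim T_M`, `δ = (1 - dim V') + δ₁`) — the conclusion of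
[Waldschmidt1988, Thm 4.1] for `d₀ = 1`, `d₂ = 0`, `n = d - 1` (period term dropped).
[cite: Waldschmidt1988, §4 Thm 4.1] -/
theorem linearSubgroup_GaGm {K : Type*} [Field K] [NumberField K] (σ : K →+* ℂ)
    {n l t m' : ℕ} (hm : m' ≤ n)
    (a : Fin l → K) (θK : Fin l → Fin (n + 1) → K) (hθ : ∀ k h, θK k h ≠ 0)
    (z : Fin (n + 1) → Fin l → ℂ) (hz : ∀ h k, cexp (z h k) = σ (θK k h))
    (εK : Fin t → K × (Fin (n + 1) → K))
    (V : Submodule ℂ (ℂ × (Fin (n + 1) → ℂ))) (bV : Basis (Fin (m' + 1)) ℂ V)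
    (hb0 : ((bV 0 : V) : ℂ × (Fin (n + 1) → ℂ)).1 = 1)
    (hbi : ∀ i, i ≠ 0 → ((bV i : V) : ℂ × (Fin (n + 1) → ℂ)).1 = 0)
    (hyV : ∀ k, ((σ (a k), fun h => z h k) : ℂ × (Fin (n + 1) → ℂ)) ∈ V)
    (heV : ∀ l', ((σ (εK l').1, fun h => σ ((εK l').2 h)) : ℂ × (Fin (n + 1) → ℂ)) ∈ V)
    (hW : 0 < finrank ℂ (Submodule.span ℂ (Set.range fun l' =>
      ((σ (εK l').1, fun h => σ ((εK l').2 h)) : ℂ × (Fin (n + 1) → ℂ)))))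
    {b : ℕ} (hb : 1 ≤ b) (ha : ∀ k, IsIntegral ℤ ((b : K) * a k))
    (hθb : ∀ k h, IsIntegral ℤ ((b : K) * θK k h))
    (hε : ∀ l', IsIntegral ℤ ((b : K) * (εK l').1) ∧ ∀ h, IsIntegral ℤ ((b : K) * (εK l').2 h)) :
    ∃ H : ConnAlgSubgroup (n + 1), ¬ (H.addPart = true ∧ H.chars = ⊥) ∧
      ∃ (r : ℕ) (ρ : Fin r → Fin l → ℤ), LinearIndependent ℤ ρ ∧
        (∀ i, sig (fun k => σ (a k)) z (ρ i) ∈ H.toSubgroup) ∧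
        finrank ℂ (Submodule.span ℂ (Set.range fun l' =>
            ((σ (εK l').1, fun h => σ ((εK l').2 h)) : ℂ × (Fin (n + 1) → ℂ)))) -
          finrank ℂ ↥(Submodule.span ℂ (Set.range fun l' =>
            ((σ (εK l').1, fun h => σ ((εK l').2 h)) : ℂ × (Fin (n + 1) → ℂ))) ⊓ H.tangent) <
          (1 - H.addDim) + (n + 1 - H.torusDim) ∧
        (l - r) + (n + 1 - H.torusDim) + (n + 1) *
          (finrank ℂ (Submodule.span ℂ (Set.range fun l' =>
            ((σ (εK l').1, fun h => σ ((εK l').2 h)) : ℂ × (Fin (n + 1) → ℂ)))) -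
            finrank ℂ ↥(Submodule.span ℂ (Set.range fun l' =>
              ((σ (εK l').1, fun h => σ ((εK l').2 h)) : ℂ × (Fin (n + 1) → ℂ))) ⊓ H.tangent)) ≤
          (n + 1) * ((1 - H.addDim) + (n + 1 - H.torusDim)) :=
  linearSubgroup_of_vanishing (N := n + 1) (Nat.succ_pos n) (fun k => σ (a k)) z _ hW
    (fun S => Nat.log 2 S + 1) (fun _ => Nat.succ_pos _) tendsto_natLog_two_add_one
    (eventually_natLog_pow_le _) (C₁ := 1) le_rfl
    (exists_auxiliaryPolynomial σ hm a θK hθ z hz εK V bV hb0 hbi hyV heV hb ha hθb hε)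

end Literature.NumberTheory.Transcendental.LinearSubgroupGaGm

end
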